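import Mathlib.GroupTheory.Perm.Cycle.Basic
import Mathlib.GroupTheory.Perm.List
import HarnessLib

/-!
# Cycle surgery for permutations: transpositions, 3-cycles, first-return maps; `formPerm` of a
# concatenation

Topic `Literature/GroupTheory/CombinatorialGroupTheory` (tools for the vertex cycles of quadratic
words, `QuadraticWordsVertexDefs.lean` / `QuadraticWordsVertices.lean`).  Elementary facts about
the cycles (`Equiv.Perm.SameCycle`) of a permutation of a finite type that is modified at two or
three points, stated with POINTWISE hypotheses (`τ x = ρ x` off the modified points) so that they
apply to permutations given by lists:

* `SameCycle.mem_of_forall_apply_mem` — a stable set containing `u` contains the cycle of `u`;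
  `SameCycle.of_forall_apply_eq` — permutations agreeing on a stable set have the same cycles there;
* `sameCycle_of_threeCycle` — composing a cycle `… → c → a → … → b → …` with the 3-cycle
  `(a b c)` taken in the cyclic order keeps one cycle;
* `sameCycle_of_swap_merge` / `sameCycle_of_swap_split` — a transposition of two points in
  different cycles merges them; with an invariant partition, the converse splitting;
* `sameCycle_of_firstReturn`, `sameCycle_of_firstReturn'` — the first-return (induced) map on
  the complement of a set `D` has, outside `D`, the cycles of the original permutation;
* `formPerm_append_eq` — for Mathlib's `List.formPerm` ("each element goes to the next"):
  `formPerm (M ++ N) = formPerm M * formPerm N * swap M.last N.last`, with the pointwise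
  consequences `formPerm_append_apply_left/right/getLast_left/getLast_right`, and
  `formPerm_apply_mid` (`P ++ a :: b :: Q` sends `a` to `b`), `exists_split_succ`.

Standard combinatorial topology of surfaces given by words (ZVC §3.1); no new definitions.
-/

namespace Literature.GroupTheory.CombinatorialGroupTheory

open List Equiv Equiv.Perm

/-! ### Cycles of a permutation modified at two or three points -/

section Perm

variable {α : Type*}

/-- A set stable under `f` and containing `u` contains the whole cycle of `u`. [cite: ZieschangVogtColdewey1980, 3.1.2] -/
theorem SameCycle.mem_of_forall_apply_mem [Finite α] {f : Perm α} {T : Set α}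
    (hT : ∀ x ∈ T, f x ∈ T) {u x : α} (hu : u ∈ T) (h : f.SameCycle u x) : x ∈ T := by
  obtain ⟨n, rfl⟩ := h.exists_nat_pow_eq
  clear h
  induction n with
  | zero => simpa using hu
  | succ n ih => rw [pow_succ', Perm.mul_apply]; exact hT _ ih

/-- Two permutations agreeing on an `f`-stable set containing `u` have the same cycle through `u`
there. [cite: ZieschangVogtColdewey1980, 3.1.2] -/
theorem SameCycle.of_forall_apply_eq [Finite α] {f g : Perm α} {S : Set α}
    (hS : ∀ x ∈ S, f x ∈ S) (hfg : ∀ x ∈ S, f x = g x) {u x : α} (hu : u ∈ S)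
    (h : f.SameCycle u x) : g.SameCycle u x := by
  obtain ⟨n, rfl⟩ := h.exists_nat_pow_eq
  clear h
  suffices hn : (f ^ n) u ∈ S ∧ (g ^ n) u = (f ^ n) u by
    rw [← hn.2]; exact (sameCycle_pow_right (f := g)).2 SameCycle.rfl
  induction n with
  | zero => simpa using hu
  | succ n ih =>
    rw [pow_succ', Perm.mul_apply, pow_succ', Perm.mul_apply, ih.2, ← hfg _ ih.1]
    exact ⟨hS _ ih.1, rfl⟩

/-- **A cycle composed with a 3-cycle in cyclic order stays a cycle.**  Let `a, b, c` be distinct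
points of one cycle of `ρ` with `ρ c = a`, and let `τ` agree with `ρ ∘ (a b c)`: `τ a = ρ b`,
`τ b = ρ c = a`, `τ c = ρ a`, `τ = ρ` elsewhere.  Then the `ρ`-cycle of `a` is contained in the
`τ`-cycle of `a`. [cite: ZieschangVogtColdewey1980, 3.1.5] -/
theorem sameCycle_of_threeCycle [Finite α] [DecidableEq α] {ρ τ : Perm α} {a b c : α}
    (hab : a ≠ b) (hρc : ρ c = a)
    (hτa : τ a = ρ b) (hτb : τ b = a) (hτc : τ c = ρ a)
    (hτ : ∀ x, x ≠ a → x ≠ b → x ≠ c → τ x = ρ x) (hb : ρ.SameCycle a b) {x : α}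
    (hx : ρ.SameCycle a x) : τ.SameCycle a x := by
  classical
  set O : Set α := {y | τ.SameCycle a y} with hO
  have hOτ : ∀ y ∈ O, τ y ∈ O := fun y hy => (sameCycle_apply_right (f := τ)).2 hy
  have haO : a ∈ O := (SameCycle.rfl : τ.SameCycle a a)
  have hbO : b ∈ O := by
    have h : τ.SameCycle b (τ b) := (sameCycle_apply_right (f := τ)).2 SameCycle.rfl
    rw [hτb] at h
    exact h.symm
  -- the least `n` with `ρ^n b = c`
  have hbc : ρ.SameCycle b c := by
    have h : ρ.SameCycle c (ρ c) := (sameCycle_apply_right (f := ρ)).2 SameCycle.rfl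
    rw [hρc] at h
    exact hb.symm.trans h.symm
  obtain ⟨n₀, hn₀⟩ := hbc.exists_nat_pow_eq
  let P : ℕ → Prop := fun n => (ρ ^ n) b = c
  have hP : ∃ n, P n := ⟨n₀, hn₀⟩
  set n := Nat.find hP with hn
  have hnc : (ρ ^ n) b = c := Nat.find_spec hP
  have hmin : ∀ k < n, (ρ ^ k) b ≠ c := fun k hk => Nat.find_min hP hk
  have key : ∀ k ≤ n, (ρ ^ k) b ∈ O := by
    intro k
    induction k with
    | zero => intro; simpa using hbO
    | succ k ih =>
      intro hk
      have hkO := ih (by omega)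
      have hya : (ρ ^ k) b ≠ a := by
        intro h
        cases k with
        | zero => exact hab.symm (by simpa using h)
        | succ k' =>
          have : (ρ ^ k') b = c := by
            apply ρ.injective
            rw [hρc, ← h, pow_succ', Perm.mul_apply]
          exact hmin k' (by omega) this
      have hyc : (ρ ^ k) b ≠ c := hmin k (by omega)
      rw [pow_succ', Perm.mul_apply]
      by_cases hyb : (ρ ^ k) b = b
      · rw [hyb, ← hτa]; exact hOτ _ haO
      · rw [← hτ _ hya hyb hyc]; exact hOτ _ hkO
  have hcO : c ∈ O := hnc ▸ key n le_rfl
  have hOρ : ∀ y ∈ O, ρ y ∈ O := by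
    intro y hy
    by_cases hya : y = a
    · rw [hya, ← hτc]; exact hOτ _ hcO
    by_cases hyb : y = b
    · rw [hyb, ← hτa]; exact hOτ _ haO
    by_cases hyc : y = c
    · rw [hyc, hρc]; exact haO
    rw [← hτ y hya hyb hyc]; exact hOτ _ hy
  exact SameCycle.mem_of_forall_apply_mem hOρ haO hx

/-- Orbit bookkeeping for `sameCycle_of_swap_merge`. [folklore] -/
private theorem swap_merge_aux [Finite α] {ρ τ : Perm α} {u v : α} (O : Set α)
    (hO : ∀ y ∈ O, τ y ∈ O) (hbase : ρ v ∈ O) (hτ : ∀ y, y ≠ u → y ≠ v → τ y = ρ y)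
    (hne : ∀ k : ℕ, (ρ ^ k) v ≠ u) : ∀ k : ℕ, (ρ ^ k) v ∈ O := by
  have h1 : ∀ k, 1 ≤ k → (ρ ^ k) v ∈ O := by
    intro k hk
    induction k with
    | zero => omega
    | succ k ih =>
      rcases Nat.eq_zero_or_pos k with rfl | hk'
      · simpa using hbase
      have hkO := ih hk'
      rw [pow_succ', Perm.mul_apply]
      by_cases hyv : (ρ ^ k) v = v
      · rw [hyv]; exact hbase
      · rw [← hτ _ (hne k) hyv]; exact hO _ hkO
  intro k
  rcases Nat.eq_zero_or_pos k with rfl | hk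
  · have hN : (ρ ^ orderOf ρ) v = v := by rw [pow_orderOf_eq_one]; rfl
    rw [← hN]
    exact h1 _ (orderOf_pos ρ)
  · exact h1 k hk

/-- **A transposition of two points in different cycles merges the two cycles.**  If `τ` agrees
with `ρ ∘ (u v)` (`τ u = ρ v`, `τ v = ρ u`, `τ = ρ` elsewhere) and `u, v` lie in different
cycles of `ρ`, the `τ`-cycle of `u` contains both `ρ`-cycles. [cite: ZieschangVogtColdewey1980, 3.1.6] -/
theorem sameCycle_of_swap_merge [Finite α] {ρ τ : Perm α} {u v : α}
    (hτu : τ u = ρ v) (hτv : τ v = ρ u) (hτ : ∀ x, x ≠ u → x ≠ v → τ x = ρ x)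
    (hnot : ¬ ρ.SameCycle u v) {x : α} (hx : ρ.SameCycle u x ∨ ρ.SameCycle v x) :
    τ.SameCycle u x := by
  set O : Set α := {y | τ.SameCycle u y}
  have hO : ∀ y ∈ O, τ y ∈ O := fun y hy => (sameCycle_apply_right (f := τ)).2 hy
  have huO : u ∈ O := (SameCycle.rfl : τ.SameCycle u u)
  have hv : ∀ k : ℕ, (ρ ^ k) v ∈ O := by
    refine swap_merge_aux O hO (by rw [← hτu]; exact hO _ huO) hτ fun k hk => hnot ?_
    have h := (sameCycle_pow_right (f := ρ) (n := k) (x := v) (y := v)).2 SameCycle.rfl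
    rw [hk] at h
    exact h.symm
  have hvO : v ∈ O := by simpa using hv 0
  have hu : ∀ k : ℕ, (ρ ^ k) u ∈ O := by
    refine swap_merge_aux O hO (by rw [← hτv]; exact hO _ hvO) (fun y h1 h2 => hτ y h2 h1)
      fun k hk => hnot ?_
    have h := (sameCycle_pow_right (f := ρ) (n := k) (x := u) (y := u)).2 SameCycle.rfl
    rw [hk] at h
    exact h
  rcases hx with hx | hx
  · obtain ⟨k, rfl⟩ := hx.exists_nat_pow_eq; exact hu k
  · obtain ⟨k, rfl⟩ := hx.exists_nat_pow_eq; exact hv k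

/-- **Splitting off an invariant part.**  If `τ` agrees with `ρ ∘ (u v)` as above, `ρ` preserves
two disjoint sets `P ∋ u` and `Q ∋ v`, and `x ∈ P` lies in the `τ`-cycle of `u`, then `x` lies in
the `ρ`-cycle of `u`. [cite: ZieschangVogtColdewey1980, 3.1.6] -/
theorem sameCycle_of_swap_split [Finite α] {ρ τ : Perm α} {u v : α}
    (hτu : τ u = ρ v) (hτv : τ v = ρ u) (hτ : ∀ x, x ≠ u → x ≠ v → τ x = ρ x)
    {P Q : Set α} (hP : ∀ x ∈ P, ρ x ∈ P) (hQ : ∀ x ∈ Q, ρ x ∈ Q) (hPQ : Disjoint P Q)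
    (hu : u ∈ P) (hv : v ∈ Q) {x : α} (hxP : x ∈ P) (hx : τ.SameCycle u x) : ρ.SameCycle u x := by
  set C : Set α := {y | ρ.SameCycle u y}
  have hCP : C ⊆ P := fun y hy => SameCycle.mem_of_forall_apply_mem hP hu hy
  have hT : ∀ y ∈ C ∪ Q, τ y ∈ C ∪ Q := by
    rintro y (hy | hy)
    · by_cases hyu : y = u
      · rw [hyu, hτu]; exact Or.inr (hQ v hv)
      have hyv : y ≠ v := fun h => hPQ.le_bot ⟨hCP hy, h ▸ hv⟩
      rw [hτ y hyu hyv]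
      exact Or.inl ((sameCycle_apply_right (f := ρ)).2 hy)
    · by_cases hyv : y = v
      · rw [hyv, hτv]; exact Or.inl ((sameCycle_apply_right (f := ρ)).2 SameCycle.rfl)
      have hyu : y ≠ u := fun h => hPQ.le_bot ⟨h ▸ hu, hy⟩
      rw [hτ y hyu hyv]
      exact Or.inr (hQ y hy)
  have hxT : x ∈ C ∪ Q := SameCycle.mem_of_forall_apply_mem hT (Or.inl SameCycle.rfl) hx
  exact hxT.resolve_right fun h => hPQ.le_bot ⟨hxP, h⟩

/-- **First-return maps.**  Suppose that outside a set `D` the permutation `σ'` is the first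
return of `φ` to the complement of `D`: `σ' o = φ^{m o} o` with `m o ≥ 1` and
`φ^k o ∈ D` for `0 < k < m o`, and `σ'` preserves the complement of `D`.  Then points outside `D`
in one `φ`-cycle are in one `σ'`-cycle. [cite: ZieschangVogtColdewey1980, 3.1.6 (b)] -/
theorem sameCycle_of_firstReturn [Finite α] {φ σ' : Perm α} {D : Set α} (m : α → ℕ)
    (hm : ∀ o, o ∉ D → 1 ≤ m o) (hret : ∀ o, o ∉ D → (φ ^ m o) o = σ' o)
    (hmid : ∀ o, o ∉ D → ∀ k, 1 ≤ k → k < m o → (φ ^ k) o ∈ D)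
    (hσ' : ∀ o, o ∉ D → σ' o ∉ D) {x z : α} (hx : x ∉ D) (hz : z ∉ D)
    (h : φ.SameCycle x z) : σ'.SameCycle x z := by
  set O : Set α := {w | w ∉ D ∧ σ'.SameCycle x w} ∪
    {d | d ∈ D ∧ ∃ o, o ∉ D ∧ σ'.SameCycle x o ∧ ∃ k, 1 ≤ k ∧ k < m o ∧ (φ ^ k) o = d}
  have hO : ∀ w ∈ O, φ w ∈ O := by
    rintro w (⟨hwD, hw⟩ | ⟨-, o, hoD, ho, k, hk1, hkm, rfl⟩)
    · by_cases h1 : m w = 1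
      · left
        have e : φ w = σ' w := by rw [← hret w hwD, h1, pow_one]
        rw [e]
        exact ⟨hσ' w hwD, (sameCycle_apply_right (f := σ')).2 hw⟩
      · right
        have h1' : 1 < m w := lt_of_le_of_ne (hm w hwD) (Ne.symm h1)
        exact ⟨by simpa using hmid w hwD 1 le_rfl h1', w, hwD, hw, 1, le_rfl, h1', by simp⟩
    · have e : φ ((φ ^ k) o) = (φ ^ (k + 1)) o := by rw [pow_succ', Perm.mul_apply]
      rw [e]
      by_cases hk : k + 1 = m o
      · left
        rw [hk, hret o hoD]
        exact ⟨hσ' o hoD, (sameCycle_apply_right (f := σ')).2 ho⟩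
      · right
        have hk' : k + 1 < m o := lt_of_le_of_ne hkm hk
        exact ⟨hmid o hoD (k + 1) (by omega) hk', o, hoD, ho, k + 1, by omega, hk', rfl⟩
  have hxO : x ∈ O := Or.inl ⟨hx, SameCycle.rfl⟩
  rcases SameCycle.mem_of_forall_apply_mem hO hxO h with ⟨-, hz'⟩ | ⟨hzD, -⟩
  · exact hz'
  · exact absurd hzD hz

/-- Converse of `sameCycle_of_firstReturn`: a `σ'`-cycle outside `D` lies in a `φ`-cycle.
[cite: ZieschangVogtColdewey1980, 3.1.6 (b)] -/
theorem sameCycle_of_firstReturn' [Finite α] {φ σ' : Perm α} {D : Set α} (m : α → ℕ)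
    (hret : ∀ o, o ∉ D → (φ ^ m o) o = σ' o) (hσ' : ∀ o, o ∉ D → σ' o ∉ D)
    {x z : α} (hx : x ∉ D) (h : σ'.SameCycle x z) : φ.SameCycle x z := by
  obtain ⟨n, rfl⟩ := h.exists_nat_pow_eq
  clear h
  suffices hn : (σ' ^ n) x ∉ D ∧ φ.SameCycle x ((σ' ^ n) x) from hn.2
  induction n with
  | zero => exact ⟨by simpa using hx, by simpa using SameCycle.rfl⟩
  | succ n ih =>
    rw [pow_succ', Perm.mul_apply]
    refine ⟨hσ' _ ih.1, ih.2.trans ?_⟩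
    rw [← hret _ ih.1]
    exact (sameCycle_pow_right (f := φ)).2 SameCycle.rfl

end Perm

/-! ### `formPerm` of a concatenation -/

section FormPerm

variable {α : Type*} [DecidableEq α]

/-- **`formPerm` of a concatenation**: for nonempty `M`, `N` with `M ++ N` duplicate-free,
`formPerm (M ++ N) = formPerm M * formPerm N * swap M.last N.last`. [cite: ZieschangVogtColdewey1980, 3.1.1] -/
theorem formPerm_append_eq : ∀ (M N : List α) (hd : (M ++ N).Nodup) (hM : M ≠ []) (hN : N ≠ []),
    formPerm (M ++ N) = formPerm M * formPerm N * swap (M.getLast hM) (N.getLast hN)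
  | [], _, _, hM, _ => absurd rfl hM
  | _, [], _, _, hN => absurd rfl hN
  | [x], n :: N, hd, _, _ => by
    have hx : x ∉ n :: N := (nodup_cons.1 hd).1
    have e : swap x n = formPerm (n :: N) * swap x ((n :: N).getLast (cons_ne_nil n N)) *
        (formPerm (n :: N))⁻¹ := by
      rw [← swap_apply_apply, formPerm_apply_of_notMem hx, formPerm_apply_getLast]
    rw [singleton_append, formPerm_cons_cons, formPerm_singleton, one_mul, e, inv_mul_cancel_right,
      getLast_singleton]
  | x :: m :: M, n :: N, hd, _, _ => by
    have hd' : ((m :: M) ++ (n :: N)).Nodup := (nodup_cons.1 hd).2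
    rw [cons_append, cons_append, formPerm_cons_cons, ← cons_append,
      formPerm_append_eq (m :: M) (n :: N) hd' (cons_ne_nil m M) (cons_ne_nil n N),
      formPerm_cons_cons, getLast_cons (cons_ne_nil m M)]
    simp only [mul_assoc]

variable {M N : List α}

/-- In `M ++ N`, a letter of `M` other than the last one goes to its successor in `M`.
[cite: ZieschangVogtColdewey1980, 3.1.1] -/
theorem formPerm_append_apply_left (hd : (M ++ N).Nodup) {x : α} (hx : x ∈ M)
    (hl : ∀ h : M ≠ [], x ≠ M.getLast h) : formPerm (M ++ N) x = formPerm M x := by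
  have hM : M ≠ [] := ne_nil_of_mem hx
  rcases eq_or_ne N [] with rfl | hN
  · rw [append_nil]
  have hxN : x ∉ N := fun h => (disjoint_of_nodup_append hd) hx h
  rw [formPerm_append_eq M N hd hM hN, Perm.mul_apply, Perm.mul_apply,
    swap_apply_of_ne_of_ne (hl hM) (fun h => hxN (h ▸ getLast_mem hN)), formPerm_apply_of_notMem hxN]

/-- In `M ++ N`, a letter of `N` other than the last one goes to its successor in `N`.
[cite: ZieschangVogtColdewey1980, 3.1.1] -/
theorem formPerm_append_apply_right (hd : (M ++ N).Nodup) {x : α} (hx : x ∈ N)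
    (hl : ∀ h : N ≠ [], x ≠ N.getLast h) : formPerm (M ++ N) x = formPerm N x := by
  have hN : N ≠ [] := ne_nil_of_mem hx
  rcases eq_or_ne M [] with rfl | hM
  · rw [nil_append]
  have hxM : x ∉ M := fun h => (disjoint_of_nodup_append hd) h hx
  rw [formPerm_append_eq M N hd hM hN, Perm.mul_apply, Perm.mul_apply,
    swap_apply_of_ne_of_ne (fun h => hxM (by rw [h]; exact getLast_mem hM)) (hl hN)]
  exact formPerm_apply_of_notMem fun h =>
    (disjoint_of_nodup_append hd) h (formPerm_apply_mem_of_mem hx)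

/-- In `M ++ N` (both nonempty), the last letter of `M` goes to the first letter of `N`.
[cite: ZieschangVogtColdewey1980, 3.1.1] -/
theorem formPerm_append_apply_getLast_left (hd : (M ++ N).Nodup) (hM : M ≠ []) (hN : N ≠ []) :
    formPerm (M ++ N) (M.getLast hM) = N.head hN := by
  obtain ⟨n, N', rfl⟩ := exists_cons_of_ne_nil hN
  have hMN : M.getLast hM ∉ n :: N' := fun h => (disjoint_of_nodup_append hd) (getLast_mem hM) h
  rw [formPerm_append_eq M _ hd hM (cons_ne_nil n N'), Perm.mul_apply, Perm.mul_apply, swap_apply_left,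
    formPerm_apply_getLast, formPerm_apply_of_notMem, head_cons]
  exact fun h => (disjoint_of_nodup_append hd) h mem_cons_self

/-- In `M ++ N` (both nonempty), the last letter of `N` goes to the first letter of `M`.
[cite: ZieschangVogtColdewey1980, 3.1.1] -/
theorem formPerm_append_apply_getLast_right (hd : (M ++ N).Nodup) (hM : M ≠ []) (hN : N ≠ []) :
    formPerm (M ++ N) (N.getLast hN) = M.head hM := by
  obtain ⟨m, M', rfl⟩ := exists_cons_of_ne_nil hM
  have hMN : (m :: M').getLast hM ∉ N := fun h => (disjoint_of_nodup_append hd) (getLast_mem hM) h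
  rw [formPerm_append_eq _ N hd (cons_ne_nil m M') hN, Perm.mul_apply, Perm.mul_apply, swap_apply_right,
    formPerm_apply_of_notMem hMN, formPerm_apply_getLast, head_cons]

end FormPerm

/-! ### Successors inside a concatenation -/

section Mid

variable {α : Type*} [DecidableEq α]

/-- The successor of `a` in `P ++ a :: b :: Q` is `b`. [cite: ZieschangVogtColdewey1980, 3.1.1] -/
theorem formPerm_apply_mid (P Q : List α) (a b : α) (hd : (P ++ a :: b :: Q).Nodup) :
    formPerm (P ++ a :: b :: Q) a = b := by
  have h1 : P.length + 1 < (P ++ a :: b :: Q).length := by simp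
  have := formPerm_apply_lt_getElem (P ++ a :: b :: Q) hd P.length h1
  simpa using this

/-- The successor of the last letter of `a :: L` is `a`. [cite: ZieschangVogtColdewey1980, 3.1.1] -/
theorem formPerm_apply_getLast_eq_head (a : α) (L : List α) {x : α}
    (hx : x = (a :: L).getLast (cons_ne_nil a L)) : formPerm (a :: L) x = a := by
  rw [hx]; exact formPerm_apply_getLast a L

omit [DecidableEq α] in
/-- A letter of `L` other than the last one is followed by some letter: `L = L₁ ++ x :: x' :: L₂`.
[cite: ZieschangVogtColdewey1980, 3.1.1] -/
theorem exists_split_succ {L : List α} {x : α} (hx : x ∈ L) (hl : ∀ h : L ≠ [], x ≠ L.getLast h) :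
    ∃ L₁ x' L₂, L = L₁ ++ x :: x' :: L₂ := by
  obtain ⟨L₁, L₂, rfl⟩ := append_of_mem hx
  rcases L₂ with _ | ⟨x', L₂⟩
  · exact absurd (getLast_append_right (cons_ne_nil x [])).symm (hl (by simp))
  · exact ⟨L₁, x', L₂, rfl⟩

end Mid

end Literature.GroupTheory.CombinatorialGroupTheory
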